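import Mathlib.FieldTheory.Separable
import Mathlib.LinearAlgebra.Matrix.Charpoly.Coeff
import Mathlib.Algebra.MvPolynomial.CommRing
import Mathlib.Tactic.LinearCombination
import HarnessLib

/-!
# The cubic discriminant: Bézout identity, separability, and non-vanishing along diagonal scalings of an invertible `3 × 3` matrix

Topic `LinearAlgebra/Matrix`; namespace `Literature.LinearAlgebra.Matrix`.  THEOREMS ONLY (no definition, no instance, no notation, no named fact,
no `sorry`); Mathlib-only imports.

* §1 **`cubic_discriminant_bezout`** — for `p = X³ + bX² + cX + d` over any commutative ring the explicit Bézout identity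
  `A·p + B·p′ = Δ`, `Δ = b²c² − 4c³ − 4b³d − 27d² + 18bcd` the discriminant (`= −Res(p, p′)`), with `A = (18c − 6b²)X + (15bc − 4b³ − 27d)`,
  `B = (2b² − 6c)X² + (2b³ + 9d − 7bc)X + (b²c + 3bd − 4c²)` (the last row of the adjugate of the Sylvester matrix); hence
  **`separable_cubic_of_discriminant_ne_zero`**: over a field, `Δ ≠ 0 ⇒ p` separable.
* §2 **`exists_mvPolynomial_discr_charpoly_fin_three`** — over a field of characteristic `0` there is a polynomial `D` in the nine entries of a
  `3 × 3` matrix (the discriminant of the characteristic polynomial, §1 composed with `charpoly M = X³ − tr M·X² + e₂(M)·X − det M`) such that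
  (a) `D(M) ≠ 0 ⇒ charpoly M` separable (`M` regular semisimple), and (b) for EVERY invertible `g`, `t ↦ D(diag(t)·g)` is not identically zero on `K³`
  — i.e. some diagonal scaling of the rows of `g` is regular semisimple.  (b) is the rank-`3` algebra behind «the singular set of a unitary group in
  three variables is Haar-null» (consumer: the `hodgecm-mathlib` cell, crux H413, line LH6 «StCharTS», brick (J8)): witnesses `t = (1, s, 0)`-type when a
  principal cross-minor `g_ii g_jj − g_ij g_ji` is non-zero (then `D = s²m²((g_ii + s g_jj)² − 4sm)`, a non-zero polynomial of degree `≤ 4` in `s`), and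
  `t = (s, 1, 1)` when all three vanish (then `D = −s·det g·(4(s g₀₀ + g₁₁ + g₂₂)³ + 27 s·det g)`, whose cubic factor has `s`-coefficient `27 det g` once the
  others vanish); finite differences at `s = 1, 2, 3, 4` extract the coefficients.

## References
* [Lang2002] S. Lang, *Algebra*, rev. 3rd ed. (2002), IV §8 (resultant and discriminant; `Res(f, f′)` and the discriminant of a cubic).
* [HornJohnson2013] R. A. Horn, C. R. Johnson, *Matrix Analysis*, 2nd ed. (2013), §1.2 Problem 1.2.P18 (`p_A(t) = t³ − (tr A)t² + (tr adj A)t − det A`).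
-/

set_option autoImplicit false

noncomputable section

open Polynomial

namespace Literature.LinearAlgebra.Matrix

/-! ## §1 The cubic discriminant -/

section Cubic

variable {R : Type*} [CommRing R]

/-- **Bézout identity for the cubic discriminant**: for `p = X³ + bX² + cX + d`,
`((18c − 6b²)X + (15bc − 4b³ − 27d))·p + ((2b² − 6c)X² + (2b³ + 9d − 7bc)X + (b²c + 3bd − 4c²))·p′ = Δ`,
`Δ = b²c² − 4c³ − 4b³d − 27d² + 18bcd` (so `Δ = −Res(p, p′)` lies in the ideal `(p, p′)`). [cite: Lang2002, IV §8] -/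
theorem cubic_discriminant_bezout (b c d : R) :
    (C (18 * c - 6 * b ^ 2) * X + C (15 * b * c - 4 * b ^ 3 - 27 * d)) * (X ^ 3 + C b * X ^ 2 + C c * X + C d) +
        (C (2 * b ^ 2 - 6 * c) * X ^ 2 + C (2 * b ^ 3 + 9 * d - 7 * b * c) * X + C (b ^ 2 * c + 3 * b * d - 4 * c ^ 2)) *
          derivative (X ^ 3 + C b * X ^ 2 + C c * X + C d) =
      C (b ^ 2 * c ^ 2 - 4 * c ^ 3 - 4 * b ^ 3 * d - 27 * d ^ 2 + 18 * b * c * d) := by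
  have hd : derivative (X ^ 3 + C b * X ^ 2 + C c * X + C d : R[X]) = 3 * X ^ 2 + C (2 * b) * X + C c := by
    simp only [derivative_add, derivative_mul, derivative_X_pow, derivative_C, derivative_X, zero_mul, zero_add, add_zero, mul_one, map_mul,
      map_ofNat, Nat.cast_ofNat]
    ring
  rw [hd]
  simp only [map_sub, map_add, map_mul, map_pow, map_ofNat]
  ring

/-- **A cubic with non-zero discriminant is separable** (over a field): `Δ ≠ 0 ⇒ X³ + bX² + cX + d` is coprime to its derivative (divide the Bézout
identity by `Δ`). [cite: Lang2002, IV §8] -/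
theorem separable_cubic_of_discriminant_ne_zero {K : Type*} [Field K] (b c d : K)
    (h : b ^ 2 * c ^ 2 - 4 * c ^ 3 - 4 * b ^ 3 * d - 27 * d ^ 2 + 18 * b * c * d ≠ 0) :
    (X ^ 3 + C b * X ^ 2 + C c * X + C d : K[X]).Separable := by
  rw [Polynomial.separable_def]
  set Δ : K := b ^ 2 * c ^ 2 - 4 * c ^ 3 - 4 * b ^ 3 * d - 27 * d ^ 2 + 18 * b * c * d with hΔ
  set A : K[X] := C (18 * c - 6 * b ^ 2) * X + C (15 * b * c - 4 * b ^ 3 - 27 * d) with hA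
  set B : K[X] := C (2 * b ^ 2 - 6 * c) * X ^ 2 + C (2 * b ^ 3 + 9 * d - 7 * b * c) * X + C (b ^ 2 * c + 3 * b * d - 4 * c ^ 2) with hB
  have key : A * (X ^ 3 + C b * X ^ 2 + C c * X + C d) + B * derivative (X ^ 3 + C b * X ^ 2 + C c * X + C d) = C Δ :=
    cubic_discriminant_bezout b c d
  refine ⟨C Δ⁻¹ * A, C Δ⁻¹ * B, ?_⟩
  calc C Δ⁻¹ * A * (X ^ 3 + C b * X ^ 2 + C c * X + C d) + C Δ⁻¹ * B * derivative (X ^ 3 + C b * X ^ 2 + C c * X + C d)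
        = C Δ⁻¹ * (A * (X ^ 3 + C b * X ^ 2 + C c * X + C d) + B * derivative (X ^ 3 + C b * X ^ 2 + C c * X + C d)) := by ring
    _ = 1 := by rw [key, ← map_mul, inv_mul_cancel₀ h, map_one]

/-- The characteristic polynomial of a `3 × 3` matrix: `X³ − (tr M)X² + e₂(M)X − det M`, with `e₂` the sum of the principal `2 × 2` minors and `det M`
expanded (Mathlib `Matrix.det_fin_three`). [cite: HornJohnson2013, §1.2 Problem 1.2.P18] -/
theorem charpoly_fin_three_explicit (M : Matrix (Fin 3) (Fin 3) R) :
    M.charpoly = X ^ 3 + C (-(M 0 0 + M 1 1 + M 2 2)) * X ^ 2 +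
      C ((M 0 0 * M 1 1 - M 0 1 * M 1 0) + (M 0 0 * M 2 2 - M 0 2 * M 2 0) + (M 1 1 * M 2 2 - M 1 2 * M 2 1)) * X +
      C (-(M 0 0 * M 1 1 * M 2 2 - M 0 0 * M 1 2 * M 2 1 - M 0 1 * M 1 0 * M 2 2 + M 0 1 * M 1 2 * M 2 0 + M 0 2 * M 1 0 * M 2 1 -
        M 0 2 * M 1 1 * M 2 0)) := by
  have e : ∀ i j : Fin 3, M.charmatrix i j = if i = j then X - C (M i j) else - C (M i j) := by
    intro i j
    split_ifs with h
    · subst h; exact Matrix.charmatrix_apply_eq M i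
    · exact Matrix.charmatrix_apply_ne M i j h
  rw [Matrix.charpoly, Matrix.det_fin_three]
  simp only [e, map_sub, map_add, map_mul, map_neg]
  simp
  ring

end Cubic

/-! ## §2 A discriminant polynomial in the entries, non-vanishing along diagonal scalings -/

section DiagonalScaling

variable {K : Type*} [Field K] [CharZero K]

/-- Finite-difference extraction, quadratic case: if `(α + sβ)² − 4sm = 0` for `s = 1, 2, 3` then `m = 0` (second difference kills all but `2β²`, then
the first difference gives `4m`). [cite: Lang2002, IV §8] -/
private theorem eq_zero_of_quadratic_vanishes (α β m : K) (h : ∀ s : K, s ≠ 0 → (α + s * β) ^ 2 - 4 * s * m = 0) : m = 0 := by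
  have h1 := h 1 one_ne_zero
  have h2 := h 2 two_ne_zero
  have h3 := h 3 (by norm_num)
  have hβ : β ^ 2 = 0 := by linear_combination (h1 - 2 * h2 + h3) / 2
  have hβ0 : β = 0 := (pow_eq_zero_iff two_ne_zero).mp hβ
  linear_combination (h1 - h2) / 4 + ((2 * α + 3 * β) / 4) * hβ0

/-- Finite-difference extraction, cubic case: if `4(sα + e)³ + 27sδ = 0` for `s = 1, 2, 3, 4` then `δ = 0` (third difference gives `24α³`, then the
first difference gives `27δ`). [cite: Lang2002, IV §8] -/
private theorem eq_zero_of_cubic_vanishes (α e δ : K) (h : ∀ s : K, s ≠ 0 → 4 * (s * α + e) ^ 3 + 27 * s * δ = 0) : δ = 0 := by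
  have h1 := h 1 one_ne_zero
  have h2 := h 2 two_ne_zero
  have h3 := h 3 (by norm_num)
  have h4 := h 4 (by norm_num)
  have hα : α ^ 3 = 0 := by linear_combination (h4 - 3 * h3 + 3 * h2 - h1) / 24
  have hα0 : α = 0 := (pow_eq_zero_iff three_ne_zero).mp hα
  linear_combination (h2 - h1) / 27 - (4 / 27) * (7 * α ^ 2 + 9 * α * e + 3 * e ^ 2) * hα0

/-- **A discriminant polynomial for `3 × 3` matrices, non-vanishing along diagonal scalings.**  Over a field `K` of characteristic `0` there is
`D ∈ K[X_{ij} : i, j < 3]` (the discriminant of the characteristic polynomial as a polynomial in the entries) with: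
(a) for every `M ∈ M₃(K)`, `D(M) ≠ 0 ⇒ charpoly M` is separable; (b) for every `g` with `det g ≠ 0` there is `t ∈ K³` with `D(diag(t)·g) ≠ 0`.
(Witnesses for (b): `t = (1, s, 0), (1, 0, s), (0, 1, s)` when the corresponding principal cross-minor of `g` is non-zero, `t = (s, 1, 1)` otherwise, for some
`s ∈ {1, 2, 3, 4}`.) [cite: Lang2002, IV §8] [cite: HornJohnson2013, §1.2 Problem 1.2.P18] -/
theorem exists_mvPolynomial_discr_charpoly_fin_three (K : Type*) [Field K] [CharZero K] :
    ∃ D : MvPolynomial (Fin 3 × Fin 3) K,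
      (∀ M : Matrix (Fin 3) (Fin 3) K, MvPolynomial.eval (fun ij : Fin 3 × Fin 3 => M ij.1 ij.2) D ≠ 0 → M.charpoly.Separable) ∧
      (∀ g : Matrix (Fin 3) (Fin 3) K, g.det ≠ 0 →
        ∃ t : Fin 3 → K, MvPolynomial.eval (fun ij : Fin 3 × Fin 3 => (Matrix.diagonal t * g) ij.1 ij.2) D ≠ 0) := by
  -- the coefficient polynomials `b = −tr`, `c = e₂`, `d = −det` in the entries `x i j = X (i, j)`
  set x : Fin 3 → Fin 3 → MvPolynomial (Fin 3 × Fin 3) K := fun i j => MvPolynomial.X (i, j) with hx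
  set pb : MvPolynomial (Fin 3 × Fin 3) K := -(x 0 0 + x 1 1 + x 2 2) with hpb
  set pc : MvPolynomial (Fin 3 × Fin 3) K :=
    (x 0 0 * x 1 1 - x 0 1 * x 1 0) + (x 0 0 * x 2 2 - x 0 2 * x 2 0) + (x 1 1 * x 2 2 - x 1 2 * x 2 1) with hpc
  set pd : MvPolynomial (Fin 3 × Fin 3) K :=
    -(x 0 0 * x 1 1 * x 2 2 - x 0 0 * x 1 2 * x 2 1 - x 0 1 * x 1 0 * x 2 2 + x 0 1 * x 1 2 * x 2 0 + x 0 2 * x 1 0 * x 2 1 -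
      x 0 2 * x 1 1 * x 2 0) with hpd
  set D : MvPolynomial (Fin 3 × Fin 3) K :=
    pb ^ 2 * pc ^ 2 - 4 * pc ^ 3 - 4 * pb ^ 3 * pd - 27 * pd ^ 2 + 18 * pb * pc * pd with hD
  -- evaluation of `D` at the entries of `M`
  have hev : ∀ M : Matrix (Fin 3) (Fin 3) K, MvPolynomial.eval (fun ij : Fin 3 × Fin 3 => M ij.1 ij.2) D =
      (-(M 0 0 + M 1 1 + M 2 2)) ^ 2 * ((M 0 0 * M 1 1 - M 0 1 * M 1 0) + (M 0 0 * M 2 2 - M 0 2 * M 2 0) + (M 1 1 * M 2 2 - M 1 2 * M 2 1)) ^ 2 -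
        4 * ((M 0 0 * M 1 1 - M 0 1 * M 1 0) + (M 0 0 * M 2 2 - M 0 2 * M 2 0) + (M 1 1 * M 2 2 - M 1 2 * M 2 1)) ^ 3 -
        4 * (-(M 0 0 + M 1 1 + M 2 2)) ^ 3 *
          (-(M 0 0 * M 1 1 * M 2 2 - M 0 0 * M 1 2 * M 2 1 - M 0 1 * M 1 0 * M 2 2 + M 0 1 * M 1 2 * M 2 0 + M 0 2 * M 1 0 * M 2 1 -
            M 0 2 * M 1 1 * M 2 0)) -
        27 * (-(M 0 0 * M 1 1 * M 2 2 - M 0 0 * M 1 2 * M 2 1 - M 0 1 * M 1 0 * M 2 2 + M 0 1 * M 1 2 * M 2 0 + M 0 2 * M 1 0 * M 2 1 -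
            M 0 2 * M 1 1 * M 2 0)) ^ 2 +
        18 * (-(M 0 0 + M 1 1 + M 2 2)) * ((M 0 0 * M 1 1 - M 0 1 * M 1 0) + (M 0 0 * M 2 2 - M 0 2 * M 2 0) + (M 1 1 * M 2 2 - M 1 2 * M 2 1)) *
          (-(M 0 0 * M 1 1 * M 2 2 - M 0 0 * M 1 2 * M 2 1 - M 0 1 * M 1 0 * M 2 2 + M 0 1 * M 1 2 * M 2 0 + M 0 2 * M 1 0 * M 2 1 -
            M 0 2 * M 1 1 * M 2 0)) := by
    intro M
    rw [hD, hpb, hpc, hpd, hx]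
    simp only [map_sub, map_add, map_mul, map_neg, map_pow, map_ofNat, MvPolynomial.eval_X]
  refine ⟨D, fun M hM => ?_, fun g hg => ?_⟩
  · -- (a) `D(M) ≠ 0 ⇒ charpoly M` separable
    rw [hev M] at hM
    rw [charpoly_fin_three_explicit M]
    exact separable_cubic_of_discriminant_ne_zero _ _ _ hM
  · -- (b) some diagonal scaling of the rows of an invertible `g` has `D ≠ 0`
    set δ : K := g.det with hδ
    set m01 : K := g 0 0 * g 1 1 - g 0 1 * g 1 0 with hm01
    set m02 : K := g 0 0 * g 2 2 - g 0 2 * g 2 0 with hm02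
    set m12 : K := g 1 1 * g 2 2 - g 1 2 * g 2 1 with hm12
    -- `D(diag(t)·g)` in terms of the cross-minors and `det g`
    have hΦ : ∀ t : Fin 3 → K, MvPolynomial.eval (fun ij : Fin 3 × Fin 3 => (Matrix.diagonal t * g) ij.1 ij.2) D =
        (-(t 0 * g 0 0 + t 1 * g 1 1 + t 2 * g 2 2)) ^ 2 * (t 0 * t 1 * m01 + t 0 * t 2 * m02 + t 1 * t 2 * m12) ^ 2 -
          4 * (t 0 * t 1 * m01 + t 0 * t 2 * m02 + t 1 * t 2 * m12) ^ 3 -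
          4 * (-(t 0 * g 0 0 + t 1 * g 1 1 + t 2 * g 2 2)) ^ 3 * (-(t 0 * t 1 * t 2 * δ)) - 27 * (-(t 0 * t 1 * t 2 * δ)) ^ 2 +
          18 * (-(t 0 * g 0 0 + t 1 * g 1 1 + t 2 * g 2 2)) * (t 0 * t 1 * m01 + t 0 * t 2 * m02 + t 1 * t 2 * m12) * (-(t 0 * t 1 * t 2 * δ)) := by
      intro t
      rw [hev (Matrix.diagonal t * g)]
      simp only [Matrix.diagonal_mul]
      rw [hm01, hm02, hm12, hδ, Matrix.det_fin_three]
      ring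
    by_contra hall
    push Not at hall
    rcases ne_or_eq m01 0 with h01 | h01
    · -- rows `0, 1`: `t = (1, s, 0)`
      refine h01 (eq_zero_of_quadratic_vanishes (g 0 0) (g 1 1) m01 fun s hs => ?_)
      have h := hall ![1, s, 0]
      rw [hΦ] at h
      have e0 : (![1, s, 0] : Fin 3 → K) 0 = 1 := rfl
      have e1 : (![1, s, 0] : Fin 3 → K) 1 = s := rfl
      have e2 : (![1, s, 0] : Fin 3 → K) 2 = 0 := rfl
      rw [e0, e1, e2] at h
      have h' : s ^ 2 * m01 ^ 2 * ((g 0 0 + s * g 1 1) ^ 2 - 4 * s * m01) = 0 := by linear_combination h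
      rcases mul_eq_zero.mp h' with h'' | h''
      · rcases mul_eq_zero.mp h'' with h3 | h3
        · exact absurd ((pow_eq_zero_iff two_ne_zero).mp h3) hs
        · exact absurd ((pow_eq_zero_iff two_ne_zero).mp h3) h01
      · exact h''
    rcases ne_or_eq m02 0 with h02 | h02
    · -- rows `0, 2`: `t = (1, 0, s)`
      refine h02 (eq_zero_of_quadratic_vanishes (g 0 0) (g 2 2) m02 fun s hs => ?_)
      have h := hall ![1, 0, s]
      rw [hΦ] at h
      have e0 : (![1, 0, s] : Fin 3 → K) 0 = 1 := rfl
      have e1 : (![1, 0, s] : Fin 3 → K) 1 = 0 := rfl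
      have e2 : (![1, 0, s] : Fin 3 → K) 2 = s := rfl
      rw [e0, e1, e2] at h
      have h' : s ^ 2 * m02 ^ 2 * ((g 0 0 + s * g 2 2) ^ 2 - 4 * s * m02) = 0 := by linear_combination h
      rcases mul_eq_zero.mp h' with h'' | h''
      · rcases mul_eq_zero.mp h'' with h3 | h3
        · exact absurd ((pow_eq_zero_iff two_ne_zero).mp h3) hs
        · exact absurd ((pow_eq_zero_iff two_ne_zero).mp h3) h02
      · exact h''
    rcases ne_or_eq m12 0 with h12 | h12
    · -- rows `1, 2`: `t = (0, 1, s)`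
      refine h12 (eq_zero_of_quadratic_vanishes (g 1 1) (g 2 2) m12 fun s hs => ?_)
      have h := hall ![0, 1, s]
      rw [hΦ] at h
      have e0 : (![0, 1, s] : Fin 3 → K) 0 = 0 := rfl
      have e1 : (![0, 1, s] : Fin 3 → K) 1 = 1 := rfl
      have e2 : (![0, 1, s] : Fin 3 → K) 2 = s := rfl
      rw [e0, e1, e2] at h
      have h' : s ^ 2 * m12 ^ 2 * ((g 1 1 + s * g 2 2) ^ 2 - 4 * s * m12) = 0 := by linear_combination h
      rcases mul_eq_zero.mp h' with h'' | h''
      · rcases mul_eq_zero.mp h'' with h3 | h3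
        · exact absurd ((pow_eq_zero_iff two_ne_zero).mp h3) hs
        · exact absurd ((pow_eq_zero_iff two_ne_zero).mp h3) h12
      · exact h''
    -- all cross-minors vanish: `t = (s, 1, 1)`
    refine hg (eq_zero_of_cubic_vanishes (g 0 0) (g 1 1 + g 2 2) δ fun s hs => ?_)
    have h := hall ![s, 1, 1]
    rw [hΦ] at h
    have e0 : (![s, 1, 1] : Fin 3 → K) 0 = s := rfl
    have e1 : (![s, 1, 1] : Fin 3 → K) 1 = 1 := rfl
    have e2 : (![s, 1, 1] : Fin 3 → K) 2 = 1 := rfl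
    rw [e0, e1, e2, h01, h02, h12] at h
    have h' : s * δ * (4 * (s * g 0 0 + (g 1 1 + g 2 2)) ^ 3 + 27 * s * δ) = 0 := by linear_combination -h
    rcases mul_eq_zero.mp h' with h'' | h''
    · rcases mul_eq_zero.mp h'' with h3 | h3
      · exact absurd h3 hs
      · exact absurd h3 hg
    · exact h''

end DiagonalScaling

end Literature.LinearAlgebra.Matrix

end
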